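import Literature.NumberTheory.DiophantineGeometry.MayMultiplicativeGroups
import Literature.NumberTheory.DiophantineGeometry.FunctionFieldDivisorClasses
import Literature.NumberTheory.DiophantineGeometry.FunctionFieldHasseWeilProofs
import Literature.NumberTheory.DiophantineGeometry.FunctionFieldSchmidtDegreeOneExtensionProofs
import Literature.NumberTheory.DiophantineGeometry.FunctionFieldPointCountRationalProofs
import Literature.LinearAlgebra.FreeModule.SubmodulePID
import HarnessLib

/-!
# May's theorem on `E*` for a finitely generated extension `E/F` — proof

Discharges the named fact `May1972_units_fg_extension` of `MayMultiplicativeGroups`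
(G. Karpilovsky, *Unit Groups of Classical Rings*, Oxford 1988, Thm. 4.5.1, pp. 149–150 = W. May,
Proc. LMS 24 (1972)): for `E/F` finitely generated with `F₁ = algebraicClosure F E`,
`(F₁ : F) < ∞` and `Eˣ ≅ F₁ˣ × A` with `A` free abelian.

Proof as printed, by induction (here on the number of generators; Karpilovsky inducts on the
transcendence degree, the step is the same): if all generators are algebraic, `E = F₁` is finite
over `F`; otherwise pick a transcendental generator `t`, put `L = F(t)`, get `Eˣ = L₁ˣ ⊕ A₂` with
`L₁ = algebraicClosure L E` finite over `L` by induction, and apply the transcendence-degree-one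
case (Karpilovsky Thm. 4.1.21) to the finite extension `L₁ ⊇ F(t)`: `L₁ˣ = F₁ˣ ⊕ A₁`.  Thm. 4.1.21
("`K` finite over `F(X)`, `L` = algebraic closure of `F` in `K` ⇒ `(L:F) < ∞` and `K* ≅ L* × A`")
is obtained from the in-tree Stichtenoth-style theory of algebraic function fields of one variable
(`AlgFunctionField.PlaceOver`, `principalDivisor`, all proved): Karpilovsky's map
`ψ : K* → ∏ᵢ vᵢ(K)` (Lemma 4.1.20: discrete valuations, finitely many non-trivial at each `k`) is
the divisor map `Kˣ → Div(K/F₁) = (PlaceOver F₁ K →₀ ℤ)` over the full constant field `F₁`, its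
kernel is `F₁ˣ` (`exists_eq_algebraMap_of_principalDivisor_eq_zero`, Stichtenoth `ℒ(0) = K̃`, in
place of Lemma 4.1.18 + `v_c(X) > 1`), its image is free as a subgroup of a free abelian group
(`Submodule.free_of_isPrincipalIdealRing`, Hungerford IV.6.1), and `(F₁ : F) < ∞` is
`finiteDimensional_algebraicClosure` (Stichtenoth Cor. 1.1.16).  Free quotients split, so all
statements are carried as internal direct sums of `ℤ`-submodules of `Additive Eˣ`.

## References
* G. Karpilovsky, *Unit Groups of Classical Rings*, Oxford Math. Monographs (1988), §4.1 (Thm.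
  4.1.21), §4.5 (Thm. 4.5.1). [Karpilovsky1988]
* W. May, *Multiplicative groups of fields*, Proc. London Math. Soc. (3) 24 (1972) 295–306.
-/

noncomputable section

namespace Literature.NumberTheory.DiophantineGeometry

open AlgFunctionField

namespace May1972

/-! ### Abelian-group lemmas (splitting off free quotients) -/

/-- If `φ : V → M` is a `ℤ`-linear map into a free `ℤ`-module, then `ker φ` has a free complement
(the image is free as a subgroup of a free abelian group, Hungerford IV.6.1, hence projective, so
`V → im φ` splits). [folklore] -/
theorem exists_isCompl_ker_of_free {V M : Type*} [AddCommGroup V] [AddCommGroup M]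
    [Module.Free ℤ M] (φ : V →ₗ[ℤ] M) :
    ∃ A : Submodule ℤ V, IsCompl (LinearMap.ker φ) A ∧ Module.Free ℤ A := by
  haveI : Module.Free ℤ (LinearMap.range φ) := Submodule.free_of_isPrincipalIdealRing _
  obtain ⟨s, hs⟩ := Module.projective_lifting_property φ.rangeRestrict LinearMap.id
    φ.surjective_rangeRestrict
  have hs' : ∀ y, φ.rangeRestrict (s y) = y := fun y => LinearMap.congr_fun hs y
  have hsinj : Function.Injective s := fun a b h => by rw [← hs' a, ← hs' b, h]
  refine ⟨LinearMap.range s, ?_, Module.Free.of_equiv (LinearEquiv.ofInjective s hsinj)⟩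
  let f : V →ₗ[ℤ] LinearMap.range s :=
    LinearMap.codRestrict (LinearMap.range s) (s ∘ₗ φ.rangeRestrict)
      (fun v => LinearMap.mem_range_self s _)
  have hf : ∀ x : LinearMap.range s, f x = x := by
    rintro ⟨_, y, rfl⟩
    apply Subtype.ext
    simp [f, hs' y]
  have hker : LinearMap.ker f = LinearMap.ker φ := by
    ext v
    simp only [LinearMap.mem_ker, f]
    rw [← Subtype.coe_inj, LinearMap.codRestrict_apply, Submodule.coe_zero, LinearMap.comp_apply,
      map_eq_zero_iff s hsinj, ← Subtype.coe_inj, LinearMap.codRestrict_apply]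
    rfl
  have := LinearMap.isCompl_of_proj hf
  rw [hker] at this
  exact this.symm

/-- Tower lemma: if `K` has the free complement `A₂` in `V`, and `H` has the complement `A₁`
inside `K`, then `H` has the complement `A₁ ⊔ A₂` in `V`. [folklore] -/
theorem isCompl_sup_of_tower {V : Type*} [AddCommGroup V] {H K A₁ A₂ : Submodule ℤ V}
    (hK : IsCompl K A₂) (hHK : H ≤ K) (hA₁K : A₁ ≤ K) (hd : Disjoint H A₁) (hs : H ⊔ A₁ = K) :
    IsCompl H (A₁ ⊔ A₂) := by
  constructor
  · rw [Submodule.disjoint_def]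
    intro x hxH hxA
    obtain ⟨a₁, ha₁, a₂, ha₂, rfl⟩ := Submodule.mem_sup.mp hxA
    have ha₂K : a₂ ∈ K := by
      have : a₁ + a₂ - a₁ ∈ K := K.sub_mem (hHK hxH) (hA₁K ha₁)
      simpa using this
    have ha₂0 : a₂ = 0 := (Submodule.disjoint_def.mp hK.disjoint) a₂ ha₂K ha₂
    subst ha₂0
    rw [add_zero] at hxH ⊢
    exact (Submodule.disjoint_def.mp hd) a₁ hxH ha₁
  · rw [codisjoint_iff, ← sup_assoc, hs]
    exact hK.sup_eq_top

/-- The sum of two disjoint free submodules is free. [folklore] -/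
theorem free_sup_of_disjoint {V : Type*} [AddCommGroup V] {A₁ A₂ : Submodule ℤ V}
    (h : Disjoint A₁ A₂) [Module.Free ℤ A₁] [Module.Free ℤ A₂] : Module.Free ℤ ↥(A₁ ⊔ A₂) := by
  let f := A₁.subtype.coprod A₂.subtype
  have hinj : Function.Injective f := by
    rw [← LinearMap.ker_eq_bot]
    rw [LinearMap.ker_coprod_of_disjoint_range]
    · simp
    · simpa using h
  have hrange : LinearMap.range f = A₁ ⊔ A₂ := by
    simp [f, LinearMap.range_coprod]
  exact Module.Free.of_equiv ((LinearEquiv.ofInjective f hinj).trans (LinearEquiv.ofEq _ _ hrange))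

/-- The units of an intermediate field, as a `ℤ`-submodule of `Additive Eˣ`. [folklore] -/
theorem exists_submodule_units {F E : Type*} [Field F] [Field E] [Algebra F E]
    (S : IntermediateField F E) :
    ∃ H : Submodule ℤ (Additive Eˣ), ∀ u, u ∈ H ↔ ((Additive.toMul u : Eˣ) : E) ∈ S := by
  let H₀ : AddSubgroup (Additive Eˣ) :=
    { carrier := {u | ((Additive.toMul u : Eˣ) : E) ∈ S}
      add_mem' := fun {a b} ha hb => by
        simp only [Set.mem_setOf_eq, toMul_add, Units.val_mul] at ha hb ⊢
        exact S.mul_mem ha hb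
      zero_mem' := by simp
      neg_mem' := fun {a} ha => by
        simp only [Set.mem_setOf_eq, toMul_neg, Units.val_inv_eq_inv_val] at ha ⊢
        exact S.inv_mem ha }
  exact ⟨AddSubgroup.toIntSubmodule H₀, fun u => Iff.rfl⟩

/-! ### The transcendence-degree-one case (Karpilovsky Thm. 4.1.21) -/

/-- **Karpilovsky Thm. 4.1.21, freeness part, in split form.** For an algebraic function field of
one variable `Ω/F`, the group `Ωˣ` is the direct sum of the units of the algebraic closure `F̃` of
`F` in `Ω` and a free abelian group: the divisor map `Ωˣ → Div(Ω/F̃)` (Karpilovsky's `ψ`, with the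
discrete valuations of Lemma 4.1.20) has free image (a subgroup of the free group of divisors) and
kernel exactly `F̃ˣ` (Stichtenoth `ℒ(0) = K̃`). [cite: Karpilovsky1988, Thm 4.1.21] -/
theorem core (F Ω : Type*) [Field F] [Field Ω] [Algebra F Ω] [IsAlgFunctionField F Ω] :
    ∃ H A : Submodule ℤ (Additive Ωˣ),
      (∀ u, u ∈ H ↔ ((Additive.toMul u : Ωˣ) : Ω) ∈ algebraicClosure F Ω) ∧
        IsCompl H A ∧ Module.Free ℤ A := by
  haveI : IsAlgFunctionField (algebraicClosure F Ω) Ω := isAlgFunctionField_algebraicClosure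
  haveI : IsIntegrallyClosedIn (algebraicClosure F Ω) Ω := isIntegrallyClosedIn_algebraicClosure
  let φ₀ : Additive Ωˣ →+ Divisor (algebraicClosure F Ω) Ω :=
    { toFun := fun u => principalDivisor (algebraicClosure F Ω) ((Additive.toMul u : Ωˣ) : Ω)
      map_zero' := by simp [principalDivisor_one]
      map_add' := fun u v => by
        simp only [toMul_add, Units.val_mul]
        exact principalDivisor_mul (Units.ne_zero _) (Units.ne_zero _) }
  obtain ⟨A, hA, hfree⟩ := exists_isCompl_ker_of_free φ₀.toIntLinearMap
  refine ⟨LinearMap.ker φ₀.toIntLinearMap, A, fun u => ?_, hA, hfree⟩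
  rw [LinearMap.mem_ker]
  change principalDivisor (algebraicClosure F Ω) ((Additive.toMul u : Ωˣ) : Ω) = 0 ↔ _
  constructor
  · intro h
    obtain ⟨c, -, hc⟩ := exists_eq_algebraMap_of_principalDivisor_eq_zero (Units.ne_zero _) h
    rw [← hc]
    exact c.2
  · intro h
    have : ((Additive.toMul u : Ωˣ) : Ω) =
        algebraMap (algebraicClosure F Ω) Ω ⟨((Additive.toMul u : Ωˣ) : Ω), h⟩ := rfl
    rw [this]
    refine principalDivisor_algebraMap fun h0 => ?_
    exact Units.ne_zero (Additive.toMul u) (congrArg Subtype.val h0)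

/-! ### Transport along a subfield `Ω ⊆ E` -/

/-- If `Ω → E` is an `F`-embedding whose image contains the algebraic closure of `F` in `E`, and
the algebraic closure of `F` in `Ω` is finite over `F`, then so is the algebraic closure of `F` in
`E` (they are isomorphic). [folklore] -/
theorem finiteDimensional_algebraicClosure_of_algHom {F Ω E : Type*} [Field F] [Field Ω] [Field E]
    [Algebra F Ω] [Algebra F E] (f : Ω →ₐ[F] E)
    (hrange : ∀ x : E, IsAlgebraic F x → x ∈ f.range)
    [FiniteDimensional F (algebraicClosure F Ω)] : FiniteDimensional F (algebraicClosure F E) := by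
  have hf : Function.Injective f := f.toRingHom.injective
  let g : algebraicClosure F Ω →ₗ[F] algebraicClosure F E :=
    { toFun := fun ω => ⟨f ω, mem_algebraicClosure_iff.2
        ((isAlgebraic_algHom_iff f hf).2 (mem_algebraicClosure_iff.1 ω.2))⟩
      map_add' := fun a b => Subtype.ext (by simp)
      map_smul' := fun c a => Subtype.ext (by simp) }
  refine Module.Finite.of_surjective g fun x => ?_
  obtain ⟨ω, hω⟩ := hrange x (mem_algebraicClosure_iff.1 x.2)
  have hωalg : IsAlgebraic F ω := (isAlgebraic_algHom_iff f hf).1 (hω ▸ mem_algebraicClosure_iff.1 x.2)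
  exact ⟨⟨ω, mem_algebraicClosure_iff.2 hωalg⟩, Subtype.ext hω⟩

/-- Transport of a free complement of `F̃(Ω)ˣ` in `Ωˣ` along an `F`-embedding `f : Ω → E`: the
image `A₁` of the complement is free, meets the constants `H = F̃(E)ˣ` trivially, and
`H ⊔ A₁ = f(Ω)ˣ =: K` (provided `F̃(E) ⊆ f(Ω)`, i.e. `H ≤ K`). [folklore] -/
theorem transport {F Ω E : Type*} [Field F] [Field Ω] [Field E] [Algebra F Ω] [Algebra F E]
    (f : Ω →ₐ[F] E) {H' A' : Submodule ℤ (Additive Ωˣ)}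
    (hH' : ∀ u, u ∈ H' ↔ ((Additive.toMul u : Ωˣ) : Ω) ∈ algebraicClosure F Ω)
    (hc' : IsCompl H' A') [Module.Free ℤ A']
    {H K : Submodule ℤ (Additive Eˣ)}
    (hH : ∀ u, u ∈ H ↔ ((Additive.toMul u : Eˣ) : E) ∈ algebraicClosure F E)
    (hK : ∀ u, u ∈ K ↔ ((Additive.toMul u : Eˣ) : E) ∈ f.range) (hle : H ≤ K) :
    ∃ A₁ : Submodule ℤ (Additive Eˣ), Module.Free ℤ A₁ ∧ A₁ ≤ K ∧ Disjoint H A₁ ∧ H ⊔ A₁ = K := by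
  have hf : Function.Injective f := f.toRingHom.injective
  let j : Ωˣ →* Eˣ := Units.map (f : Ω →* E)
  have hj : Function.Injective j := Units.map_injective hf
  let ja : Additive Ωˣ →ₗ[ℤ] Additive Eˣ := (MonoidHom.toAdditive j).toIntLinearMap
  have hja : Function.Injective ja := hj
  have hja_coe : ∀ w : Additive Ωˣ, ((Additive.toMul (ja w) : Eˣ) : E) = f (Additive.toMul w : Ωˣ) :=
    fun w => rfl
  refine ⟨A'.map ja, Module.Free.of_equiv (Submodule.equivMapOfInjective ja hja A'), ?_, ?_, ?_⟩
  · -- `A₁ ≤ K`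
    rintro _ ⟨w, -, rfl⟩
    rw [hK, hja_coe]
    exact ⟨_, rfl⟩
  · -- `H ⊓ A₁ = 0`
    rw [Submodule.disjoint_def]
    rintro _ hxH ⟨w, hw, rfl⟩
    rw [hH, hja_coe] at hxH
    have hwH : w ∈ H' := by
      rw [hH', mem_algebraicClosure_iff]
      exact (isAlgebraic_algHom_iff f hf).1 (mem_algebraicClosure_iff.1 hxH)
    have hw0 : w = 0 := (Submodule.disjoint_def.mp hc'.disjoint) w hwH hw
    rw [hw0, map_zero]
  · -- `H ⊔ A₁ = K`
    apply le_antisymm (sup_le hle ?_)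
    · intro u hu
      rw [hK] at hu
      obtain ⟨ω, hω⟩ := hu
      have hω0 : ω ≠ 0 := by
        rintro rfl
        exact (Additive.toMul u).ne_zero (by rw [← hω, map_zero])
      have hu' : ja (Additive.ofMul (Units.mk0 ω hω0)) = u := by
        apply Additive.toMul.injective
        exact Units.ext hω
      have hmem : Additive.ofMul (Units.mk0 ω hω0) ∈ H' ⊔ A' := by
        rw [hc'.sup_eq_top]; exact Submodule.mem_top
      obtain ⟨h', hh', a', ha', hsum⟩ := Submodule.mem_sup.mp hmem
      rw [← hu', ← hsum, map_add]
      refine Submodule.add_mem_sup ?_ (Submodule.mem_map_of_mem ha')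
      rw [hH, hja_coe, mem_algebraicClosure_iff, isAlgebraic_algHom_iff f hf,
        ← mem_algebraicClosure_iff]
      exact (hH' _).1 hh'
    · rintro _ ⟨w, -, rfl⟩
      rw [hK, hja_coe]
      exact ⟨_, rfl⟩

/-! ### Induction on the number of generators (Karpilovsky Thm. 4.5.1) -/

/-- The algebraic case: if `E = F(s)` with every element of `s` algebraic over `F`, then `E = F̃`
is finite over `F` and the complement is trivial ("If `E/F` is algebraic, then `E = F₁` and there
is nothing to prove", Karpilovsky p. 149). [cite: Karpilovsky1988, Thm 4.5.1 (proof)] -/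
theorem step_algebraic (F E : Type*) [Field F] [Field E] [Algebra F E] (s : Finset E)
    (halg : ∀ x ∈ s, IsAlgebraic F x) (hgen : IntermediateField.adjoin F (s : Set E) = ⊤) :
    FiniteDimensional F (algebraicClosure F E) ∧
      ∃ H A : Submodule ℤ (Additive Eˣ),
        (∀ u, u ∈ H ↔ ((Additive.toMul u : Eˣ) : E) ∈ algebraicClosure F E) ∧
          IsCompl H A ∧ Module.Free ℤ A := by
  haveI : FiniteDimensional F (IntermediateField.adjoin F (s : Set E)) :=
    IntermediateField.finiteDimensional_adjoin fun x hx => (halg x hx).isIntegral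
  haveI : FiniteDimensional F E := by
    rw [hgen] at this
    exact LinearEquiv.finiteDimensional
      (IntermediateField.topEquiv (F := F) (E := E)).toLinearEquiv
  haveI : Algebra.IsAlgebraic F E := Algebra.IsAlgebraic.of_finite F E
  refine ⟨inferInstance, ⊤, ⊥, fun u => ?_, isCompl_top_bot, inferInstance⟩
  simp only [Submodule.mem_top, true_iff]
  exact mem_algebraicClosure_iff.2 (Algebra.IsAlgebraic.isAlgebraic _)

/-- **Karpilovsky Thm. 4.5.1, split form, by induction on the number of generators.** For
`E = F(s)` finitely generated: `F̃ = algebraicClosure F E` is finite over `F` and `F̃ˣ` has a free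
complement in `Eˣ`. Step (Karpilovsky p. 150): pick `t ∈ s` transcendental, `L = F(t)`; by
induction `Eˣ = L̃ˣ ⊕ A₂` with `L̃ = algebraicClosure L E` finite over `L`, so `L̃` is a finite
extension of `F(t)` and Thm. 4.1.21 (`core`) gives `L̃ˣ = F̃ˣ ⊕ A₁`; hence `Eˣ = F̃ˣ ⊕ (A₁ ⊕ A₂)`.
[cite: Karpilovsky1988, Thm 4.5.1] -/
theorem main (n : ℕ) : ∀ (F E : Type) [Field F] [Field E] [Algebra F E] (s : Finset E),
    s.card ≤ n → IntermediateField.adjoin F (s : Set E) = ⊤ →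
    FiniteDimensional F (algebraicClosure F E) ∧
      ∃ H A : Submodule ℤ (Additive Eˣ),
        (∀ u, u ∈ H ↔ ((Additive.toMul u : Eˣ) : E) ∈ algebraicClosure F E) ∧
          IsCompl H A ∧ Module.Free ℤ A := by
  induction n with
  | zero =>
    intro F E _ _ _ s hs hgen
    exact step_algebraic F E s (fun x hx => absurd (Finset.card_pos.2 ⟨x, hx⟩) (by omega)) hgen
  | succ n ih =>
    intro F E _ _ _ s hs hgen
    classical
    by_cases halg : ∀ x ∈ s, IsAlgebraic F x
    · exact step_algebraic F E s halg hgen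
    push Not at halg
    obtain ⟨t, hts, ht⟩ := halg
    set L : IntermediateField F E := IntermediateField.adjoin F {t} with hL
    haveI : IsAlgFunctionField F L := isAlgFunctionField_adjoin_simple ht
    have hgen' : IntermediateField.adjoin L ((s.erase t : Finset E) : Set E) = ⊤ := by
      apply IntermediateField.restrictScalars_injective F
      rw [IntermediateField.restrictScalars_top, IntermediateField.restrictScalars_adjoin]
      refine top_unique ?_
      rw [← hgen]
      refine IntermediateField.adjoin.mono F _ _ fun x hx => ?_
      by_cases hxt : x = t
      · left
        rw [hxt]
        exact IntermediateField.mem_adjoin_simple_self F t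
      · right
        rw [Finset.coe_erase]
        exact ⟨hx, hxt⟩
    have hcard : (s.erase t).card ≤ n := by
      rw [Finset.card_erase_of_mem hts]
      omega
    obtain ⟨hfinL, H_L, A₂, hH_L, hcL, hfreeL⟩ := ih L E (s.erase t) hcard hgen'
    haveI := hfinL
    haveI := hfreeL
    -- `L̃ = algebraicClosure L E` is finite over `L = F(t)`, hence a function field over `F`
    haveI : IsAlgFunctionField F (algebraicClosure L E) :=
      isAlgFunctionField_of_finiteDimensional (K := F) (F := L) (F' := algebraicClosure L E)
    obtain ⟨H', A', hH', hc', hfree'⟩ := core F (algebraicClosure L E)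
    haveI := hfree'
    haveI : FiniteDimensional F (algebraicClosure F (algebraicClosure L E)) :=
      finiteDimensional_algebraicClosure
    let f : algebraicClosure L E →ₐ[F] E := ((algebraicClosure L E).val).restrictScalars F
    have hf : ∀ x : E, x ∈ f.range ↔ x ∈ algebraicClosure L E := fun x =>
      ⟨fun ⟨ω, hω⟩ => hω ▸ ω.2, fun hx => ⟨⟨x, hx⟩, rfl⟩⟩
    have hrange : ∀ x : E, IsAlgebraic F x → x ∈ f.range := fun x hx =>
      (hf x).2 (mem_algebraicClosure_iff.2 (hx.tower_top L))
    obtain ⟨H, hH⟩ := exists_submodule_units (algebraicClosure F E)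
    have hK : ∀ u, u ∈ H_L ↔ ((Additive.toMul u : Eˣ) : E) ∈ f.range := fun u => by
      rw [hH_L, hf]
    have hle : H ≤ H_L := fun u hu => by
      rw [hH_L]
      rw [hH, mem_algebraicClosure_iff] at hu
      exact mem_algebraicClosure_iff.2 (hu.tower_top L)
    obtain ⟨A₁, hfree₁, hA₁K, hdisj, hsup⟩ := transport f hH' hc' hH hK hle
    haveI := hfree₁
    exact ⟨finiteDimensional_algebraicClosure_of_algHom f hrange, H, A₁ ⊔ A₂, hH,
      isCompl_sup_of_tower hcL hle hA₁K hdisj hsup,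
      free_sup_of_disjoint (hcL.disjoint.mono_left hA₁K)⟩

end May1972

open May1972 in
/-- **May 1972 / Karpilovsky 1988 Thm. 4.5.1 (first part), discharged:** for a finitely generated
field extension `E/F` with `F₁ = algebraicClosure F E`, `(F₁ : F) < ∞` and
`Eˣ ≅ F₁ˣ × (free abelian group)`. Proof as printed (Karpilovsky pp. 149–150): induction, the
transcendence-degree-one step being Thm. 4.1.21 (valuations of a finite extension of `F(X)` trivial
on `F`; here via the in-tree Stichtenoth divisor theory `AlgFunctionField.principalDivisor`), and
a subgroup of a free abelian group is free. [cite: Karpilovsky1988, Thm 4.5.1] -/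
theorem May1972_units_fg_extension_holds : May1972_units_fg_extension := by
  intro F E _ _ _ hfg
  classical
  obtain ⟨s, hs⟩ := hfg
  obtain ⟨hfin, H, A, hH, hc, hfree⟩ := main s.card F E s le_rfl hs
  haveI := hfree
  refine ⟨hfin, Module.Free.ChooseBasisIndex ℤ A, ⟨?_⟩⟩
  -- `Additive Eˣ ≃ H × A`
  let e₁ : Additive Eˣ ≃ₗ[ℤ] (H × A) := (Submodule.prodEquivOfIsCompl H A hc).symm
  -- `A ≃ FreeAbelianGroup ι`
  let e₂ : A ≃+ FreeAbelianGroup (Module.Free.ChooseBasisIndex ℤ A) :=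
    (Module.Free.chooseBasis ℤ A).repr.toAddEquiv.trans
      (FreeAbelianGroup.equivFinsupp (Module.Free.ChooseBasisIndex ℤ A)).symm
  -- `F₁ˣ ≃ H`
  let ψ : (algebraicClosure F E)ˣ →* Eˣ :=
    Units.map (algebraMap (algebraicClosure F E) E : algebraicClosure F E →+* E).toMonoidHom
  have hψ : Function.Injective ψ :=
    Units.map_injective (algebraMap (algebraicClosure F E) E).injective
  have hψmem : ∀ u : (algebraicClosure F E)ˣ, Additive.ofMul (ψ u) ∈ H := fun u =>
    (hH _).2 (u : algebraicClosure F E).2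
  let χ : (algebraicClosure F E)ˣ →* Multiplicative H :=
    { toFun := fun u => Multiplicative.ofAdd ⟨Additive.ofMul (ψ u), hψmem u⟩
      map_one' := by
        apply Multiplicative.toAdd.injective
        apply Subtype.ext
        simp
      map_mul' := fun u v => by
        apply Multiplicative.toAdd.injective
        apply Subtype.ext
        simp }
  have hχ : Function.Bijective χ := by
    constructor
    · intro u v h
      apply hψ
      have h' := congrArg (fun x : Multiplicative H =>
        Additive.toMul ((Multiplicative.toAdd x : H) : Additive Eˣ)) h
      simpa [χ] using h'
    · intro x
      have hx : ((Additive.toMul ((Multiplicative.toAdd x : H) : Additive Eˣ) : Eˣ) : E) ∈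
          algebraicClosure F E := (hH _).1 (Multiplicative.toAdd x).2
      have hinv : (((Additive.toMul ((Multiplicative.toAdd x : H) : Additive Eˣ) : Eˣ)⁻¹ : Eˣ) : E) ∈
          algebraicClosure F E := by
        rw [Units.val_inv_eq_inv_val]
        exact (algebraicClosure F E).inv_mem hx
      refine ⟨⟨⟨_, hx⟩, ⟨_, hinv⟩, Subtype.ext (Units.mul_inv _), Subtype.ext (Units.inv_mul _)⟩, ?_⟩
      apply Multiplicative.toAdd.injective
      apply Subtype.ext
      apply Additive.toMul.injective
      exact Units.ext rfl
  let e₃ : (algebraicClosure F E)ˣ ≃* Multiplicative H := MulEquiv.ofBijective χ hχ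
  exact (MulEquiv.multiplicativeAdditive Eˣ).symm.trans <|
    (AddEquiv.toMultiplicative e₁.toAddEquiv).trans <|
      (MulEquiv.prodMultiplicative H A).trans <|
        MulEquiv.prodCongr e₃.symm (AddEquiv.toMultiplicative e₂)

end Literature.NumberTheory.DiophantineGeometry
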